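/-
Copyright (c) 2026 the pub-hodgecm-mathlib formalisation cell (harness21).  Prover seat hodgecm-mathlib-LH4-p13 (g8), req620 Track A «(D-RAM) FOUR-FRAME» squad, tier 0,
STAGE-1b PRE-SCOPING (heir LEAD F0P3a-plan (g20) T19-24∕T19-31 (R-29)(b); dealer LH4-plan (g12) WORD #45∕#50 «(α) ↦ p13»): organ (L-lab) «THE LABEL LAW» — brick (L-lab-11)
«THE ONE-SLOT LAW IN THE DIAGONAL MODEL»: on a lattice `latt A` where one slot of the model norm form is `ϖ^m`-negligible, the model label of ★ p859223 is the label of ONE scalar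
multiple `e • X₊` of the reference nilpotent (the model twin of ★ p858774 ∕ p858873, for every reading of ★ p859340).  2026-09-04.
-/
import Summits.HodgeConjecture.HodgeConjecture.Theorems.F0P3cDyRamFrameEltOneSlotLabel      -- ★ p858774 (this lineage, (L-lab-1)): `setOf_slot_eq_valueSetMod_smul_xPlus`; brings ★ (L-lab-0), ★ `pairing_smul_xPlus_mulVec`, ★ №3 Pieces
import Summits.HodgeConjecture.HodgeConjecture.Theorems.F0P3cDyRamLatticeFunctionalImage    -- ★ p858873 (this lineage, (L-lab-2)): `exists_principal_functional_image`
import HarnessLib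

/-!
# Crux `H413`, line LH4 «(D-RAM) FOUR-FRAME», tier 0, STAGE-1b pre-scoping — (L-lab-11) «THE ONE-SLOT LAW IN THE DIAGONAL MODEL»: a `ϖ^m`-negligible slot drops out of the
# model norm form, the surviving coordinate image of `latt A` is principal, and the model label becomes `LabelPlus σ ϖ d m (e • X₊)` for an explicit scalar `e`

Cell `hodgecm-mathlib` (D-0151), FLOOR 0, crux item H413 = `stmt-HodgeConjecture-24833`, route of record `HCCMUnconditional`; squad F0∕P3c∕LH4.  SCOPING INVENTORY for the
STAGE-1b directive ((α₁)∕(β₁) on the type-(1) population, PRESCOPE (L-lab) v3 f0ecf9c5 §2 (a): the ONE-SLOT-DOMINANT strata).  THEOREMS ONLY (no `def`, no instance, no notation,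
no `sorry`, default heartbeats), ★-only imports, lane `--supports stmt-HodgeConjecture-24833 --as helper`; pays NO row, states NO law.

THE MATHEMATICS.  In ★ p859223's model the `T₊` label of a frame element at a lattice `M` of `(K³, diag(c))` is the class of the thickened norm-form value set
`{C₀·N(y₀) + C₁·N(y₁) | y ∈ M} + ϖ^m𝒪` (`Cᵢ = cᵢ·(root)`, `N(a) = a·σa`; ★ p859340 gives the two other readings `C₀N(y₀) + C₂N(y₂)`, `C₁N(y₁) + C₂N(y₂)`).  The coordinates are
`Φ₃`-functionals — `y₀ = ⟨e₂, y⟩_{Φ₃}`, `y₁ = ⟨e₁, y⟩_{Φ₃}`, `y₂ = ⟨e₀, y⟩_{Φ₃}` (§1) — so ★ (L-lab-2) makes every coordinate image of `latt A` PRINCIPAL, `= s⋆·𝒪`, and ★ (L-lab-1)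
`setOf_slot_eq_valueSetMod_smul_xPlus` turns a ONE-TERM thickened set `{C·N(yᵢ)}~` into `valueSetMod σ ϖ m (e • xPlus σ ϖ d)` for every `e` with `e·t₊ = C·N(s⋆)` (§2).  If the
OTHER term is `ϖ^m`-negligible on `M` (`∀ y ∈ M, |(ϖ^m)⁻¹·C_j·N(y_j)| ≤ 1`) it drops (§3), so (§4) the model label `{C_i N(y_i) + C_j N(y_j)}~ = valueSetMod σ ϖ m (X₊)` holds iff
`LabelPlus σ ϖ d m (e • X₊)` — decided by ★ (L-lab-3) `labelPlus_smul_xPlus_iff_exists_norm(_of_congr)` (`e` a unit congruent to a `σ`-fixed one: its norm class) and, for the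
negative class, «LabelMinus′» likewise.  On the one-slot-dominant strata of the labelled Stage-B table (core-hanging, on-branch, and the glued ones IN THE RIGHT READING) this is
the whole label read: the label is CONSTANT on the stratum and equal to `ω(cᵢ)·ω(root part)` — κ-covariant in the frame.

* §1 `apply_zero_eq_pairing_single_two`, `apply_one_eq_pairing_single_one`, `apply_two_eq_pairing_single_zero` (coordinates as `Φ₃`-functionals).
* §2 `exists_generator_setOf_norm_coord_eq_valueSetMod_smul_xPlus` (one-term set on `latt A`, any slot: ∃ `s⋆`, ∀ `C e`, `e·t₊ = C·N(s⋆) →` the set is `valueSetMod (e • X₊)`).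
* §3 `setOf_norm_add_eq_of_snd_small`, `setOf_norm_add_eq_of_fst_small` (a negligible term drops; abstract `F, G : (Fin 3 → K) → K`).
* §4 HEADS **`exists_generator_modelLabel_iff_labelPlus_smul_of_snd_small`** ∕ **`…_of_fst_small`**: for `M = latt A`, slots `(i, j)` arbitrary, the other term negligible:
  ∃ `s⋆` (the generator of the slot-`i` coordinate image) with, for every `e` with `e·t₊ = C_i·N(s⋆)`,
  `({C_i N(y_i) + C_j N(y_j)}~ = valueSetMod σ ϖ m (xPlus σ ϖ d)) ↔ LabelPlus σ ϖ d m (e • xPlus σ ϖ d)` and the same with any reference class `c • X₊` on both sides.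
HONEST LABEL.  Count-neutral scoping brick; the three tier-0 rows stay OPEN; `HC_CM` is proved only modulo the 7 printed citations (2 remaining named inputs: hLiu418 =
`stmt-HodgeConjecture-24832`, h413 = `stmt-HodgeConjecture-24833`) until rung 0 closes.

## References
* [Rogawski1990] J. D. Rogawski, *Automorphic Representations of Unitary Groups in Three Variables*, Ann. of Math. Stud. 123 (1990), §4.9 Prop. 4.9.1 (b) p. 55.
* [Kottwitz1986BaseChangeUnits] R. E. Kottwitz, *Base change for unit elements of Hecke algebras*, Compositio Math. 60 (1986), §1 pp. 240–241.
* [Serre1979] J.-P. Serre, *Local Fields*, GTM 67 (1979), Ch. I §1 (fractional ideals of a DVR are principal), Ch. V §3 Cor. 3.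
* [LanglandsShelstad1987] R. P. Langlands, D. Shelstad, *On the definition of transfer factors*, Math. Ann. 278 (1987), §3.
-/

set_option autoImplicit false

noncomputable section

namespace Summit.HodgeConjecture.HodgeConjecture.Cruxes.H413.F0P3cDyRamModelOneSlotLabel

open Literature.NumberTheory.Automorphic Literature.NumberTheory.Automorphic.HermitianLattice
open Literature.NumberTheory.Automorphic.UnitaryLatticeTree Literature.NumberTheory.Automorphic.UnitaryThreeFourFrame
open Summit.HodgeConjecture.HodgeConjecture.Cruxes.H413.F0P3cDyRamFourFramePieces
open Summit.HodgeConjecture.HodgeConjecture.Cruxes.H413.F0P3cDyRamFourFrameCensusDefs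
open Summit.HodgeConjecture.HodgeConjecture.Cruxes.H413.F0P3cDyRamFrameEltOneSlotLabel (setOf_slot_eq_valueSetMod_smul_xPlus)
open Summit.HodgeConjecture.HodgeConjecture.Cruxes.H413.F0P3cDyRamLatticeFunctionalImage (exists_principal_functional_image)
open scoped Matrix MatrixGroups Valued WithZero

variable {K : Type} [Field K] [Valued K ℤᵐ⁰]

/-! ## §1  The coordinates as `Φ₃`-functionals -/

omit [Valued K ℤᵐ⁰] in
/-- `y₀ = ⟨e₂, y⟩_{Φ₃}`. [cite: Rogawski1990, §4.9 Prop. 4.9.1 (b) p. 55] -/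
theorem apply_zero_eq_pairing_single_two (σ : K →+* K) (y : Fin 3 → K) :
    y 0 = pairing σ ((StdForm.antidiagonal 3).over K) (Pi.single 2 1) y := by
  rw [pairing_antidiagonal, B₀_single_left]; rfl

omit [Valued K ℤᵐ⁰] in
/-- `y₁ = ⟨e₁, y⟩_{Φ₃}`. [cite: Rogawski1990, §4.9 Prop. 4.9.1 (b) p. 55] -/
theorem apply_one_eq_pairing_single_one (σ : K →+* K) (y : Fin 3 → K) :
    y 1 = pairing σ ((StdForm.antidiagonal 3).over K) (Pi.single 1 1) y := by
  rw [pairing_antidiagonal, B₀_single_left]; rfl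

omit [Valued K ℤᵐ⁰] in
/-- `y₂ = ⟨e₀, y⟩_{Φ₃}`. [cite: Rogawski1990, §4.9 Prop. 4.9.1 (b) p. 55] -/
theorem apply_two_eq_pairing_single_zero (σ : K →+* K) (y : Fin 3 → K) :
    y 2 = pairing σ ((StdForm.antidiagonal 3).over K) (Pi.single 0 1) y := by
  rw [pairing_antidiagonal, B₀_single_left]; rfl

omit [Valued K ℤᵐ⁰] in
/-- Every coordinate is a `Φ₃`-functional: `y i = ⟨e_{rev i}, y⟩_{Φ₃}`. [cite: Rogawski1990, §4.9 Prop. 4.9.1 (b) p. 55] -/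
theorem apply_eq_pairing_single_rev (σ : K →+* K) (y : Fin 3 → K) (i : Fin 3) :
    y i = pairing σ ((StdForm.antidiagonal 3).over K) (Pi.single (Fin.rev i) 1) y := by
  rw [pairing_antidiagonal, B₀_single_left, Fin.rev_rev]

/-! ## §2  A one-term norm set on `latt A` is the value set of a scalar multiple of `X₊` -/

/-- **ONE TERM, ANY SLOT**: for `M = latt A` and a slot `i` there is a generator `s⋆` of the coordinate image `{y_i | y ∈ M} = s⋆·𝒪` such that for every coefficient `C` and every `e` with
`e·t₊ = C·N(s⋆)`: `{C·N(y_i) | y ∈ M} + ϖ^m𝒪 = valueSetMod σ ϖ m (e • xPlus σ ϖ d)` (★ (L-lab-2) principal image + ★ (L-lab-1) one-slot set).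
[cite: Serre1979, Ch. I §1] [cite: Rogawski1990, §4.9 Prop. 4.9.1 (b) p. 55] -/
theorem exists_generator_setOf_norm_coord_eq_valueSetMod_smul_xPlus (σ : K →+* K) (ϖ : K) (d m : ℕ) (A : Matrix (Fin 3) (Fin 3) K) (i : Fin 3) :
    ∃ sStar : K, (∀ z : K, (∃ y ∈ latt A, y i = z) ↔ ∃ r : K, Valued.v r ≤ 1 ∧ z = sStar * r) ∧
      ∀ C e : K, e * ((ϖ - σ ϖ) * ((ϖ * σ ϖ) ^ ((d - d % 2) / 2))⁻¹) = C * (sStar * σ sStar) →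
        {z | ∃ y ∈ latt A, Valued.v ((ϖ ^ m)⁻¹ * (z - C * (y i * σ (y i)))) ≤ 1} = valueSetMod σ ϖ m (e • xPlus σ ϖ d) := by
  obtain ⟨sStar, hgen⟩ := exists_principal_functional_image σ ((StdForm.antidiagonal 3).over K) (Pi.single (Fin.rev i) 1) A
  refine ⟨sStar, fun z => ?_, fun C e he => ?_⟩
  · rw [← hgen z]
    simp only [← apply_eq_pairing_single_rev]
  · have h := setOf_slot_eq_valueSetMod_smul_xPlus σ ϖ d m (latt A) (Pi.single (Fin.rev i) 1) C sStar e hgen he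
    simp only [← apply_eq_pairing_single_rev] at h
    exact h

/-! ## §3  A `ϖ^m`-negligible term drops out of a thickened set -/

/-- If `|(ϖ^m)⁻¹·G y| ≤ 1` for every `y ∈ M`, then `{F y + G y | y ∈ M} + ϖ^m𝒪 = {F y | y ∈ M} + ϖ^m𝒪` (abstract functions `F, G`; ultrametric inequality).
[cite: Kottwitz1986BaseChangeUnits, §1 pp. 240–241] -/
theorem setOf_add_eq_of_snd_small (ϖ : K) (m : ℕ) (M : Submodule 𝒪[K] (Fin 3 → K)) (F G : (Fin 3 → K) → K)
    (hG : ∀ y ∈ M, Valued.v ((ϖ ^ m)⁻¹ * G y) ≤ 1) :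
    {z | ∃ y ∈ M, Valued.v ((ϖ ^ m)⁻¹ * (z - (F y + G y))) ≤ 1} = {z | ∃ y ∈ M, Valued.v ((ϖ ^ m)⁻¹ * (z - F y)) ≤ 1} := by
  ext z
  simp only [Set.mem_setOf_eq]
  constructor
  · rintro ⟨y, hy, hz⟩
    refine ⟨y, hy, ?_⟩
    have key := Valuation.map_add_le _ hz (hG y hy)
    convert key using 2
    ring
  · rintro ⟨y, hy, hz⟩
    refine ⟨y, hy, ?_⟩
    have key := Valuation.map_sub_le _ hz (hG y hy)
    convert key using 2
    ring

/-- Symmetric version: a negligible FIRST term drops. [cite: Kottwitz1986BaseChangeUnits, §1 pp. 240–241] -/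
theorem setOf_add_eq_of_fst_small (ϖ : K) (m : ℕ) (M : Submodule 𝒪[K] (Fin 3 → K)) (F G : (Fin 3 → K) → K)
    (hF : ∀ y ∈ M, Valued.v ((ϖ ^ m)⁻¹ * F y) ≤ 1) :
    {z | ∃ y ∈ M, Valued.v ((ϖ ^ m)⁻¹ * (z - (F y + G y))) ≤ 1} = {z | ∃ y ∈ M, Valued.v ((ϖ ^ m)⁻¹ * (z - G y)) ≤ 1} := by
  have h := setOf_add_eq_of_snd_small ϖ m M G F hF
  simp only [add_comm (G _)] at h
  exact h

/-! ## §4  Heads: the model label on a one-slot-dominant lattice is `LabelPlus (e • X₊)` -/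

/-- **THE ONE-SLOT LAW IN THE DIAGONAL MODEL (second term negligible).**  `M = latt A`, slots `i, j`, coefficients `C_i, C_j`; if `∀ y ∈ M, |(ϖ^m)⁻¹·C_j·N(y_j)| ≤ 1` then there is
a generator `s⋆` of the slot-`i` image of `M` such that for every `e` with `e·t₊ = C_i·N(s⋆)` and every reference scalar `c`:
`{C_i·N(y_i) + C_j·N(y_j) | y ∈ M}~ = valueSetMod σ ϖ m (c • X₊)  ↔  valueSetMod σ ϖ m (e • X₊) = valueSetMod σ ϖ m (c • X₊)` — at `c = 1` the right side is
`LabelPlus σ ϖ d m (e • xPlus σ ϖ d)` (★ (L-lab-3) decides it by the norm class of `e`), at `c` a non-norm unit it is «LabelMinus′».  The model twin of ★ p858774's one-slot law; with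
★ p859340's three readings it covers every one-slot-dominant stratum of the labelled Stage-B table. [cite: Rogawski1990, §4.9 Prop. 4.9.1 (b) p. 55] [cite: LanglandsShelstad1987, §3]
[cite: Kottwitz1986BaseChangeUnits, §1 pp. 240–241] -/
theorem exists_generator_modelLabel_iff_of_snd_small (σ : K →+* K) (ϖ : K) (d m : ℕ) (A : Matrix (Fin 3) (Fin 3) K) (i j : Fin 3) (Ci Cj : K)
    (hsmall : ∀ y ∈ latt A, Valued.v ((ϖ ^ m)⁻¹ * (Cj * (y j * σ (y j)))) ≤ 1) :
    ∃ sStar : K, (∀ z : K, (∃ y ∈ latt A, y i = z) ↔ ∃ r : K, Valued.v r ≤ 1 ∧ z = sStar * r) ∧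
      ∀ e : K, e * ((ϖ - σ ϖ) * ((ϖ * σ ϖ) ^ ((d - d % 2) / 2))⁻¹) = Ci * (sStar * σ sStar) → ∀ c : K,
        ({z | ∃ y ∈ latt A, Valued.v ((ϖ ^ m)⁻¹ * (z - (Ci * (y i * σ (y i)) + Cj * (y j * σ (y j))))) ≤ 1} = valueSetMod σ ϖ m (c • xPlus σ ϖ d) ↔
          valueSetMod σ ϖ m (e • xPlus σ ϖ d) = valueSetMod σ ϖ m (c • xPlus σ ϖ d)) := by
  obtain ⟨sStar, hgen, hset⟩ := exists_generator_setOf_norm_coord_eq_valueSetMod_smul_xPlus σ ϖ d m A i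
  refine ⟨sStar, hgen, fun e he c => ?_⟩
  rw [setOf_add_eq_of_snd_small ϖ m (latt A) (fun y => Ci * (y i * σ (y i))) (fun y => Cj * (y j * σ (y j))) hsmall, hset Ci e he]

/-- **THE ONE-SLOT LAW IN THE DIAGONAL MODEL (first term negligible).**  Symmetric head: the FIRST term is negligible, the label is read on slot `j`.
[cite: Rogawski1990, §4.9 Prop. 4.9.1 (b) p. 55] [cite: LanglandsShelstad1987, §3] [cite: Kottwitz1986BaseChangeUnits, §1 pp. 240–241] -/
theorem exists_generator_modelLabel_iff_of_fst_small (σ : K →+* K) (ϖ : K) (d m : ℕ) (A : Matrix (Fin 3) (Fin 3) K) (i j : Fin 3) (Ci Cj : K)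
    (hsmall : ∀ y ∈ latt A, Valued.v ((ϖ ^ m)⁻¹ * (Ci * (y i * σ (y i)))) ≤ 1) :
    ∃ sStar : K, (∀ z : K, (∃ y ∈ latt A, y j = z) ↔ ∃ r : K, Valued.v r ≤ 1 ∧ z = sStar * r) ∧
      ∀ e : K, e * ((ϖ - σ ϖ) * ((ϖ * σ ϖ) ^ ((d - d % 2) / 2))⁻¹) = Cj * (sStar * σ sStar) → ∀ c : K,
        ({z | ∃ y ∈ latt A, Valued.v ((ϖ ^ m)⁻¹ * (z - (Ci * (y i * σ (y i)) + Cj * (y j * σ (y j))))) ≤ 1} = valueSetMod σ ϖ m (c • xPlus σ ϖ d) ↔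
          valueSetMod σ ϖ m (e • xPlus σ ϖ d) = valueSetMod σ ϖ m (c • xPlus σ ϖ d)) := by
  obtain ⟨sStar, hgen, hset⟩ := exists_generator_setOf_norm_coord_eq_valueSetMod_smul_xPlus σ ϖ d m A j
  refine ⟨sStar, hgen, fun e he c => ?_⟩
  rw [setOf_add_eq_of_fst_small ϖ m (latt A) (fun y => Ci * (y i * σ (y i))) (fun y => Cj * (y j * σ (y j))) hsmall, hset Cj e he]

/-- **THE `LabelPlus` INSTANCE** (`c = 1`): second term negligible ⇒ the model label `{C_i N(y_i) + C_j N(y_j)}~ = valueSetMod σ ϖ m (xPlus σ ϖ d)` holds iff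
`LabelPlus σ ϖ d m (e • xPlus σ ϖ d)`. [cite: Rogawski1990, §4.9 Prop. 4.9.1 (b) p. 55] [cite: LanglandsShelstad1987, §3] -/
theorem exists_generator_modelLabel_iff_labelPlus_smul_of_snd_small (σ : K →+* K) (ϖ : K) (d m : ℕ) (A : Matrix (Fin 3) (Fin 3) K) (i j : Fin 3) (Ci Cj : K)
    (hsmall : ∀ y ∈ latt A, Valued.v ((ϖ ^ m)⁻¹ * (Cj * (y j * σ (y j)))) ≤ 1) :
    ∃ sStar : K, (∀ z : K, (∃ y ∈ latt A, y i = z) ↔ ∃ r : K, Valued.v r ≤ 1 ∧ z = sStar * r) ∧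
      ∀ e : K, e * ((ϖ - σ ϖ) * ((ϖ * σ ϖ) ^ ((d - d % 2) / 2))⁻¹) = Ci * (sStar * σ sStar) →
        ({z | ∃ y ∈ latt A, Valued.v ((ϖ ^ m)⁻¹ * (z - (Ci * (y i * σ (y i)) + Cj * (y j * σ (y j))))) ≤ 1} = valueSetMod σ ϖ m (xPlus σ ϖ d) ↔
          LabelPlus σ ϖ d m (e • xPlus σ ϖ d)) := by
  obtain ⟨sStar, hgen, h⟩ := exists_generator_modelLabel_iff_of_snd_small σ ϖ d m A i j Ci Cj hsmall
  refine ⟨sStar, hgen, fun e he => ?_⟩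
  have h1 := h e he 1
  rw [one_smul] at h1
  rw [h1, LabelPlus]

end Summit.HodgeConjecture.HodgeConjecture.Cruxes.H413.F0P3cDyRamModelOneSlotLabel

end
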